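import Summits.QuantumFields.BalabanUV.Beta.MultiscaleSupRowSums
import Summits.QuantumFields.BalabanUV.Beta.MultiscaleGradientMember
import Summits.QuantumFields.BalabanUV.Beta.FlatGradientBinderD4

/-!
# Beta / MultiscaleGradRowSums — THE (2.16)-CURRENCY FORM OF THE GRADIENT MEMBER (3.42)₂: EXPONENTIALLY WEIGHTED ROW SUMS OF
# `D(levelOp)⁻¹` IN `d_n` WITH THE LEVEL-FREE LOCAL PREFACTOR `n(b₋)` (one power), flat transport —
# `Σ_q |(D(levelOp)⁻¹(δ_q))(b,i)|·e^{κ′d_n(b₋,q₁)} ≤ 𝔅_∇·e^{2dδ}·N₀Λ∕(1 − Λe^{−(δ−κ′)})·n(b₋)` — the owner's file 19b BY DUALITY per source cell + the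
# cell growth sums; general `d` MODULO the binder (FG), and HYPOTHESIS-FREE in d = 4 via this lineage's `FlatGradientBinderD4` (MODEL)

WHAT IS CERTIFIED (kernel, 0 sorry).  In the MODEL setting of file 19b `MultiscaleGradientMember` (flat transport `Rm_b(k,i) = δ_{ki}`, constant weight
`c ≡ c₀ ≠ 0`, graded sides + additive datum, (P) budget, `(1+d/2)log L/R ≤ κ`, `δ = κ − (1+d/2)log L/R`, `𝔅` = file 17's constant, `𝔅_∇` = file
19b's constant):
* `lapply_eq_sum_single` — `(Φu)(y) = Σ_q u(q)·Φ(δ_q)(y)` for a linear map `(X → ℝ) →ₗ (Y → ℝ)`;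
* **`cell_gradRowSum_le`** — for every cell `k′` and bond-component `(b,i)`: `Σ_{q : q₁ ∈ cell k′} |(D G δ_q)(b,i)| ≤ 𝔅_∇·n(b₋)·e^{−δ d_n(b₋,t_{k′})}`
  (file 19b at the sign pattern of the row, MODULO (FG));
* **`wrs_grad_levelOp_inverse_le_of_growth`** ∕ **`…_of_grading`** — the weighted row sum with the local prefactor `n(b₋)` (one power, where the
  sup member's row sum `MultiscaleSupRowSums` has `n²`), abstract growth clause ∕ discharged by road P3's `cell_growth_add`;
* d = 4: pass `FlatGradientBinderD4.flatGradient_binder_d4 hcc hc₀` as `hFG` (with `K₁ = Kgrad 4`, `K₂ = 9/2·Kgrad 4 + 36·Cdip 4·Cps 4`) —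
  then NO binder and NO named fact remain (the import is kept so that the discharge is one term for every consumer).
(unit `b2b-balaban-beta-d4-p2`, GEN 11, MODEL crew; journal l.23681; consumer: the WRS-currency parametrix (w4-d)∕(w4-f).)

HONEST FRAMING: discharging `BetaPertH` makes Bałaban's UV stability UNCONDITIONAL — NOT the continuum limit, NOT the Clay problem.
HONEST DEPENDENCY (verbatim): «continuum YM on T⁴ ⇐ BetaPertH ∧ nine spine estimates (0/9 proved); BetaPertH ⇐ (D1) ∧ (D4) ∧ CAP+tail;
G-an2-4 gates asym, D1 and NE2/3/4.»  THIS MODULE DISCHARGES NOTHING of `BetaPertH`, asserts NOTHING printed and cites nothing as a fact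
(ABSOLUTE RULE): [folklore] bookkeeping about the MODEL operator with FLAT transport; nothing of Bałaban's ∇_UG′(U).  LOCATORS (shape only):
[Balaban1988RG2Cluster] (2.16) p. 15; [Balaban1985BackgroundPropagators] Thm 3.1 (3.42) p. 397.  No class change on row D4 (critical-path width 0;
D4 DISCHARGE NO DATE); NOT BetaPertH, NOT continuum, NOT Clay, NOT summit progress.
-/

open scoped BigOperators
open Finset

namespace Summit.QuantumFields.BalabanUV.Beta.MultiscaleGradRowSums

open Summit.QuantumFields.BalabanUV.Beta.BoxPoincare (Box)
open Summit.QuantumFields.BalabanUV.Beta.MultiscaleCoerciveTorus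
open Summit.QuantumFields.BalabanUV.Beta.MultiscaleDistance
open Summit.QuantumFields.BalabanUV.Beta.MultiscaleDistanceMetric (sdist_comm sdist_triangle_torus)
open Summit.QuantumFields.BalabanUV.Beta.MultiscaleDecayBudget
open Summit.QuantumFields.BalabanUV.Beta.MultiscaleDecayRowSums (sum_exp_neg_le_of_growth)
open Summit.QuantumFields.BalabanUV.Beta.MultiscaleGrowthCells (cell_growth_add)
open Summit.QuantumFields.BalabanUV.Beta.AccretiveCombesThomasSandwichSite (sdist_corner_thresholds)
open Summit.QuantumFields.BalabanUV.Beta.MultiscaleGradientMember (real_grad_levelOp_inverse_le_of_flatGradient)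
open Summit.QuantumFields.BalabanUV.Beta.HarmonicGradientInterior (Kgrad)
open Summit.QuantumFields.BalabanUV.Beta.TorusInversePowerSums (Cps Cps_nonneg)
open Summit.QuantumFields.BalabanUV.Beta.GreenGradientRowSum (Cdip Cdip_nonneg Kgrad_nonneg)
open Summit.QuantumFields.BalabanUV.Beta.FlatGradientBinderD4 (flatGradient_binder_d4)
open Summit.QuantumFields.BalabanUV.Beta.SubsolutionMeanValueBox (Cmv)
open Literature.MathematicalPhysics.QuantumFieldTheory.Balaban1983to89
open Literature.MathematicalPhysics.QuantumFieldTheory.Balaban1983to89.B9Thm37Glue (covD)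
open Literature.MathematicalPhysics.QuantumFieldTheory.Balaban1983to89.B9Thm37GluePU (bsrc btgt)
open Literature.MathematicalPhysics.QuantumFieldTheory.Balaban1983to89.B9Thm37GlueTorusCov (tblk)
open Literature.MathematicalPhysics.QuantumFieldTheory.Balaban1983to89.B9Thm37GlueTorusCovLevels (levelOp)
open B5TorusCover (UT Ctr ctrU)
open B5Leibniz121 (up)

noncomputable section

/-! ## §1 The kernel representation of a linear map between function spaces -/

/-- **`(Φu)(y) = Σ_q u(q)·Φ(δ_q)(y)`** for a linear map `(X → ℝ) →ₗ (Y → ℝ)`, `X` finite. [folklore] -/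
theorem lapply_eq_sum_single {X Y : Type} [Fintype X] [DecidableEq X] (Φ : (X → ℝ) →ₗ[ℝ] (Y → ℝ)) (u : X → ℝ) (y : Y) :
    Φ u y = ∑ q, u q * Φ (Pi.single q 1) y := by
  have hu : u = ∑ q, u q • (Pi.single q (1 : ℝ) : X → ℝ) := by
    funext p'
    rw [Finset.sum_apply]
    simp only [Pi.smul_apply, Pi.single_apply, smul_eq_mul, mul_ite, mul_one, mul_zero]
    rw [Finset.sum_ite_eq]
    simp
  conv_lhs => rw [hu]
  rw [map_sum, Finset.sum_apply]
  refine Finset.sum_congr rfl fun q _ => ?_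
  rw [map_smul, Pi.smul_apply, smul_eq_mul]

variable {d : ℕ} {N : Fin d → ℕ} [∀ i, NeZero (N i)] [NeZero d] {Cp J K : Type} [Fintype Cp] [DecidableEq Cp] [Nonempty Cp]
  [Fintype J] [Fintype K] [DecidableEq K] (S : J → ℕ) (hS : ∀ l, 1 ≤ S l) (hdivS : ∀ l i, S l ∣ N i) (lvl : K → J)
  (zc : (k : K) → Ctr N (S (lvl k)))
  (hdisj : ∀ k k' v v', cellPt S hS hdivS lvl zc k v = cellPt S hS hdivS lvl zc k' v' → k = k')
  (hcover : ∀ x : UT N, ∃ k, ∃ v : Box d (S (lvl k)), cellPt S hS hdivS lvl zc k v = x)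
  (Rm : UT N × Fin d → Cp → Cp → ℝ) (hRm : ∀ b i j, ∑ k, Rm b k i * Rm b k j = if i = j then (1 : ℝ) else 0)
  (hflat : ∀ b k i, Rm b k i = if k = i then 1 else 0)
  (T : J → UT N → Cp → Cp → ℝ) (hT : ∀ l x i i', ∑ k, T l x k i * T l x k i' = if i = i' then (1 : ℝ) else 0)
  (a : J → ℝ) (ha : ∀ j, 0 ≤ a j) (ω : J → UT N → ℝ)
  (hsupp : ∀ l x, ω l (ctrU N (S l) (tblk (hS l) (hdivS l) x)) ≠ 0 → ∃ k v, lvl k = l ∧ cellPt S hS hdivS lvl zc k v = x)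
  {amax : ℝ} (hamax : 0 ≤ amax)
  (hscale : ∀ k, a (lvl k) * ω (lvl k) (ctrU N (S (lvl k)) (zc k)) ^ 2 * (S (lvl k) : ℝ) ^ d ≤ amax / (S (lvl k) : ℝ) ^ 2)
  (c : UT N × Fin d → ℝ) {c₀ : ℝ} (hcc : ∀ b, c b = c₀) (hc₀ : c₀ ≠ 0)
  {L : ℕ} (hL : 1 ≤ L) (e : J → ℕ) (hSe : ∀ l, S l = L ^ e l) {R : ℝ} (hR : 0 < R) {A : ℕ}
  (hadd : ∀ x y : UT N, |(e (lvl (cellOf S hS hdivS lvl zc hcover x)) : ℝ) - e (lvl (cellOf S hS hdivS lvl zc hcover y))| ≤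
    A + sdist bsrc btgt (siteScale S hS hdivS lvl zc hcover) x y / R)
  {cmax : ℝ} (hc : ∀ b, |c b| ≤ cmax) {C : ℝ}
  (hcoer : ∀ f : UT N × Cp → ℝ,
    C * ∑ k, ((S (lvl k) : ℝ) ^ 2)⁻¹ * ∑ v : Box d (S (lvl k)), ∑ i, f (cellPt S hS hdivS lvl zc k v, i) ^ 2 ≤
      ∑ p, f p * levelOp bsrc btgt c Rm (fun l x => ctrU N (S l) (tblk (hS l) (hdivS l) x))
        (fun l x => ω l (ctrU N (S l) (tblk (hS l) (hdivS l) x))) T a f p)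
  {κ : ℝ} (hκ0 : 0 ≤ κ) (hκ1 : κ ≤ 1) (hμ : 0 < C - 2 * d * cmax ^ 2 * κ ^ 2 - amax * (Real.exp (2 * d * κ) - 1))
  (hrate : (1 + d / 2) * (Real.log L / R) ≤ κ)
  {Γ θ δ 𝔅 𝔅g K₁ K₂ : ℝ} (hΓ : Γ = (L : ℝ) ^ A * Real.exp (Real.log L / R * (4 * d + 1))) (hθ : θ = 1 / (4 * d * Γ))
  (hδ : δ = κ - (1 + d / 2) * (Real.log L / R))
  (h𝔅 : 𝔅 = (max (Real.sqrt (11 ^ d)) (Cmv d * Real.sqrt (21 ^ d)) / Real.sqrt (θ ^ d) +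
          Real.sqrt (Fintype.card Cp) * (θ + 1) ^ 2 * (amax * Γ ^ 2 * Real.sqrt (Γ ^ d)) / (2 * c₀ ^ 2)) *
        (Real.sqrt (Fintype.card Cp) * Real.exp (κ * ((4 * d + 1) + 2 * d)) *
          ((L : ℝ) ^ A * Real.exp (Real.log L / R * (4 * d + 1))) * (L : ℝ) ^ A * Real.sqrt (((L : ℝ) ^ A) ^ d) /
          (C - 2 * d * cmax ^ 2 * κ ^ 2 - amax * (Real.exp (2 * d * κ) - 1))) +
        Real.sqrt (Fintype.card Cp) * (θ + 1) ^ 2 / (2 * c₀ ^ 2) *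
          Real.exp ((κ - (1 + d / 2) * (Real.log L / R)) * ((4 * d + 1) + 2 * d)))
  (hK₁ : 0 ≤ K₁) (hK₂ : 0 ≤ K₂)
  (h𝔅g : 𝔅g = |c₀| * (𝔅 * (Γ ^ 2 * Real.exp δ + 1) * (16 * d * Γ) + K₁ * 𝔅 * Γ ^ 2 * Real.exp δ * (16 * d * Γ) +
      K₂ * (θ / 4 + 1) * (Real.exp (δ * (2 * d + 1)) + amax * Real.sqrt (Fintype.card Cp) * 𝔅 * Real.exp (δ * (4 * d + 1))) / c₀ ^ 2))

include hdisj hT ha hsupp hamax hscale hL e hSe hR hadd hRm hflat hcc hc₀ hc hcoer hκ0 hκ1 hμ hrate hΓ hθ hδ h𝔅 hK₁ hK₂ h𝔅g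

/-! ## §2 Duality: the gradient row sum over one source cell, MODULO (FG) -/

/-- **THE ROW SUM OF `D(levelOp)⁻¹` OVER ONE SOURCE CELL** (file 19b at the sign pattern of the row), MODULO (FG): for every cell `k′` and
bond-component `(b,i)`, `Σ_{q : q₁ ∈ cell k′} |(D(levelOp)⁻¹(δ_q))(b,i)| ≤ 𝔅_∇·n(b₋)·e^{−δ·d_n(b₋,t_{k′})}`. [folklore] -/
theorem cell_gradRowSum_le
    (hFG : ∀ (x₀ : UT N) (R : ℕ), 1 ≤ R → (∀ i, 10 * R + 4 ≤ N i) → ∀ (w : UT N → ℝ) (M G : ℝ),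
      (∀ x ∈ univ.filter (fun x : UT N => dist x x₀ ≤ 2 * R + 2), |w x| ≤ M) →
      (∀ x ∈ univ.filter (fun x : UT N => dist x x₀ ≤ 2 * R + 2),
        |((∑ b ∈ univ.filter (fun b : UT N × Fin d => btgt b = x), c b ^ 2) +
              ∑ b ∈ univ.filter (fun b : UT N × Fin d => bsrc b = x), c b ^ 2) * w x -
            ((∑ b ∈ univ.filter (fun b : UT N × Fin d => btgt b = x), c b ^ 2 * w (bsrc b)) +
              ∑ b ∈ univ.filter (fun b : UT N × Fin d => bsrc b = x), c b ^ 2 * w (btgt b))| ≤ G) →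
      ∀ μ, |w (up x₀ μ) - w x₀| ≤ K₁ * M / ((R : ℝ) + 1) + K₂ * ((R : ℝ) + 1) * G / c₀ ^ 2)
    (k' : K) (b : UT N × Fin d) (i : Cp) :
    ∑ q ∈ univ.filter (fun q : UT N × Cp => cellOf S hS hdivS lvl zc hcover q.1 = k'),
        |covD bsrc btgt c Rm ((Ring.inverse (levelOp bsrc btgt c Rm (fun l x => ctrU N (S l) (tblk (hS l) (hdivS l) x))
          (fun l x => ω l (ctrU N (S l) (tblk (hS l) (hdivS l) x))) T a)) (Pi.single q 1)) (b, i)| ≤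
      𝔅g * (siteScale S hS hdivS lvl zc hcover (bsrc b) : ℝ) *
        Real.exp (-(δ * sdist bsrc btgt (siteScale S hS hdivS lvl zc hcover) (bsrc b) (ctrU N (S (lvl k')) (zc k')))) := by
  classical
  set G := Ring.inverse (levelOp bsrc btgt c Rm (fun l x => ctrU N (S l) (tblk (hS l) (hdivS l) x))
    (fun l x => ω l (ctrU N (S l) (tblk (hS l) (hdivS l) x))) T a) with hG
  set Φ : (UT N × Cp → ℝ) →ₗ[ℝ] (((UT N × Fin d) × Cp) → ℝ) := (covD bsrc btgt c Rm) ∘ₗ G with hΦ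
  have hΦapp : ∀ u, Φ u = covD bsrc btgt c Rm (G u) := fun u => by rw [hΦ, LinearMap.comp_apply]
  set σ : UT N × Cp → ℝ := fun q => if cellOf S hS hdivS lvl zc hcover q.1 = k' then
    (if 0 ≤ Φ (Pi.single q 1) (b, i) then 1 else -1) else 0 with hσ
  have hσsupp : ∀ q, cellOf S hS hdivS lvl zc hcover q.1 ≠ k' → σ q = 0 := fun q hq => by simp only [hσ, if_neg hq]
  have hσabs : ∀ q, |σ q| ≤ 1 := by
    intro q
    simp only [hσ]
    split_ifs <;> simp
  have h19 := real_grad_levelOp_inverse_le_of_flatGradient S hS hdivS lvl zc hdisj hcover Rm hRm T hT a ha ω hsupp hamax hscale c hcc hc₀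
    hL e hSe hR hadd hflat hc hcoer hκ0 hκ1 hμ hrate hΓ hθ hδ h𝔅 hK₁ hK₂ hFG k' σ hσsupp zero_le_one hσabs b i
  rw [← h𝔅g, mul_one, ← hG] at h19
  have hdual : Φ σ (b, i) = ∑ q ∈ univ.filter (fun q : UT N × Cp => cellOf S hS hdivS lvl zc hcover q.1 = k'),
      |Φ (Pi.single q 1) (b, i)| := by
    rw [lapply_eq_sum_single Φ σ (b, i), Finset.sum_filter]
    refine Finset.sum_congr rfl fun q _ => ?_
    by_cases hq : cellOf S hS hdivS lvl zc hcover q.1 = k'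
    · simp only [hσ, hq, if_true]
      by_cases hs : 0 ≤ Φ (Pi.single q 1) (b, i)
      · rw [if_pos hs, one_mul, abs_of_nonneg hs]
      · rw [if_neg hs, abs_of_neg (lt_of_not_ge hs)]; ring
    · simp only [hσ, hq, if_false, zero_mul]
  have hgoal : ∑ q ∈ univ.filter (fun q : UT N × Cp => cellOf S hS hdivS lvl zc hcover q.1 = k'), |Φ (Pi.single q 1) (b, i)| ≤
      𝔅g * (siteScale S hS hdivS lvl zc hcover (bsrc b) : ℝ) *
        Real.exp (-(δ * sdist bsrc btgt (siteScale S hS hdivS lvl zc hcover) (bsrc b) (ctrU N (S (lvl k')) (zc k')))) := by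
    rw [← hdual, hΦapp]
    exact (le_abs_self _).trans h19
  simpa only [hΦapp] using hgoal

/-! ## §3 The weighted gradient row sum -/

/-- **THE (2.16)-CURRENCY GRADIENT MEMBER FOR `levelOp` (flat transport), LEVEL-FREE, MODULO (FG) and an abstract growth clause**:
`0 ≤ κ′ ≤ δ`, `#{k′ : d_n(t_k,t_{k′}) < m} ≤ N₀Λ^m`, `Λe^{−(δ−κ′)} < 1` ⟹ for every bond-component `(b,i)`:
`Σ_q |(D(levelOp)⁻¹(δ_q))(b,i)|·e^{κ′·d_n(b₋,q₁)} ≤ 𝔅_∇·e^{2dδ}·(N₀Λ/(1 − Λe^{−(δ−κ′)}))·n(b₋)` — ONE power of the local scale.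
[cite: Balaban1988RG2Cluster, (2.16) p.15; Balaban1985BackgroundPropagators, Thm 3.1 (3.42) p.397] [folklore] -/
theorem wrs_grad_levelOp_inverse_le_of_growth
    (hFG : ∀ (x₀ : UT N) (R : ℕ), 1 ≤ R → (∀ i, 10 * R + 4 ≤ N i) → ∀ (w : UT N → ℝ) (M G : ℝ),
      (∀ x ∈ univ.filter (fun x : UT N => dist x x₀ ≤ 2 * R + 2), |w x| ≤ M) →
      (∀ x ∈ univ.filter (fun x : UT N => dist x x₀ ≤ 2 * R + 2),
        |((∑ b ∈ univ.filter (fun b : UT N × Fin d => btgt b = x), c b ^ 2) +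
              ∑ b ∈ univ.filter (fun b : UT N × Fin d => bsrc b = x), c b ^ 2) * w x -
            ((∑ b ∈ univ.filter (fun b : UT N × Fin d => btgt b = x), c b ^ 2 * w (bsrc b)) +
              ∑ b ∈ univ.filter (fun b : UT N × Fin d => bsrc b = x), c b ^ 2 * w (btgt b))| ≤ G) →
      ∀ μ, |w (up x₀ μ) - w x₀| ≤ K₁ * M / ((R : ℝ) + 1) + K₂ * ((R : ℝ) + 1) * G / c₀ ^ 2)
    {N₀ Λ : ℝ} (hN₀ : 0 ≤ N₀) (hΛ : 0 ≤ Λ)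
    (hcount : ∀ (k : K) (m : ℕ), ((univ.filter fun k' => sdist bsrc btgt (siteScale S hS hdivS lvl zc hcover)
        (ctrU N (S (lvl k)) (zc k)) (ctrU N (S (lvl k')) (zc k')) < m).card : ℝ) ≤ N₀ * Λ ^ m)
    {κ' : ℝ} (hκ'0 : 0 ≤ κ') (hκ'δ : κ' ≤ δ) (hq : Λ * Real.exp (-(δ - κ')) < 1) (b : UT N × Fin d) (i : Cp) :
    ∑ q, |covD bsrc btgt c Rm ((Ring.inverse (levelOp bsrc btgt c Rm (fun l x => ctrU N (S l) (tblk (hS l) (hdivS l) x))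
          (fun l x => ω l (ctrU N (S l) (tblk (hS l) (hdivS l) x))) T a)) (Pi.single q 1)) (b, i)| *
        Real.exp (κ' * sdist bsrc btgt (siteScale S hS hdivS lvl zc hcover) (bsrc b) q.1) ≤
      𝔅g * Real.exp (2 * d * δ) * (N₀ * Λ / (1 - Λ * Real.exp (-(δ - κ')))) * (siteScale S hS hdivS lvl zc hcover (bsrc b) : ℝ) := by
  classical
  set G := Ring.inverse (levelOp bsrc btgt c Rm (fun l x => ctrU N (S l) (tblk (hS l) (hdivS l) x))
    (fun l x => ω l (ctrU N (S l) (tblk (hS l) (hdivS l) x))) T a) with hG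
  set n := siteScale S hS hdivS lvl zc hcover with hn
  set x := bsrc b with hx
  set F : UT N × Cp → ℝ := fun q => |covD bsrc btgt c Rm (G (Pi.single q 1)) (b, i)| with hF
  set D : K → ℝ := fun k' => sdist bsrc btgt n x (ctrU N (S (lvl k')) (zc k')) with hD
  set Dc : K → ℝ := fun k' => sdist bsrc btgt n (ctrU N (S (lvl (cellOf S hS hdivS lvl zc hcover x))) (zc (cellOf S hS hdivS lvl zc hcover x)))
    (ctrU N (S (lvl k')) (zc k')) with hDc
  have hF0 : ∀ q, 0 ≤ F q := fun q => abs_nonneg _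
  -- `𝔅_∇ ≥ 0` from §2 at any cell
  obtain ⟨k₀, -⟩ := hcover x
  have hcell0 := cell_gradRowSum_le S hS hdivS lvl zc hdisj hcover Rm hRm hflat T hT a ha ω hsupp hamax hscale c hcc hc₀ hL e hSe hR hadd
    hc hcoer hκ0 hκ1 hμ hrate hΓ hθ hδ h𝔅 hK₁ hK₂ h𝔅g hFG
  have h𝔅g0 : 0 ≤ 𝔅g := by
    have h := hcell0 k₀ b i
    have h0 : 0 ≤ ∑ q ∈ univ.filter (fun q : UT N × Cp => cellOf S hS hdivS lvl zc hcover q.1 = k₀), F q :=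
      Finset.sum_nonneg fun _ _ => abs_nonneg _
    have hpos : 0 < (n x : ℝ) * Real.exp (-(δ * sdist bsrc btgt n x (ctrU N (S (lvl k₀)) (zc k₀)))) := by
      have : (0 : ℝ) < (n x : ℝ) := by exact_mod_cast one_le_siteScale S hS hdivS lvl zc hcover x
      positivity
    have h1 : 0 ≤ 𝔅g * ((n x : ℝ) * Real.exp (-(δ * sdist bsrc btgt n x (ctrU N (S (lvl k₀)) (zc k₀))))) := by
      rw [← mul_assoc]; exact h0.trans (by simpa only [hG, hn, hx, hF] using h)
    exact nonneg_of_mul_nonneg_left h1 hpos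
  have hδκ : 0 ≤ δ - κ' := by linarith
  have hcell : ∀ k', ∑ q ∈ univ.filter (fun q : UT N × Cp => cellOf S hS hdivS lvl zc hcover q.1 = k'),
      F q * Real.exp (κ' * sdist bsrc btgt n x q.1) ≤ 𝔅g * Real.exp (2 * d * δ) * (n x : ℝ) * Real.exp (-((δ - κ') * Dc k')) := by
    intro k'
    have h2 : ∑ q ∈ univ.filter (fun q : UT N × Cp => cellOf S hS hdivS lvl zc hcover q.1 = k'), F q ≤
        𝔅g * (n x : ℝ) * Real.exp (-(δ * D k')) := by
      have h := hcell0 k' b i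
      simpa only [hG, hn, hx, hF, hD] using h
    have hw : ∀ q ∈ univ.filter (fun q : UT N × Cp => cellOf S hS hdivS lvl zc hcover q.1 = k'),
        Real.exp (κ' * sdist bsrc btgt n x q.1) ≤ Real.exp (κ' * (D k' + 2 * d)) := by
      intro q hq
      have hqk := (Finset.mem_filter.mp hq).2
      have h2d : sdist bsrc btgt n q.1 (ctrU N (S (lvl k')) (zc k')) ≤ 2 * d :=
        (sdist_corner_thresholds S hS hdivS lvl zc hdisj hcover q.1 k').1 hqk
      have htri := sdist_triangle_torus n x (ctrU N (S (lvl k')) (zc k')) q.1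
      rw [sdist_comm bsrc btgt n (ctrU N (S (lvl k')) (zc k')) q.1] at htri
      exact Real.exp_le_exp.mpr (mul_le_mul_of_nonneg_left (by simp only [hD]; linarith) hκ'0)
    have hthr : Dc k' - 2 * d ≤ D k' := by
      have h := (sdist_corner_thresholds S hS hdivS lvl zc hdisj hcover x k').2
      simpa only [hD, hDc, hn] using h
    have hexp : Real.exp (κ' * (D k' + 2 * d)) * Real.exp (-(δ * D k')) ≤ Real.exp (2 * d * δ) * Real.exp (-((δ - κ') * Dc k')) := by
      rw [← Real.exp_add, ← Real.exp_add]
      refine Real.exp_le_exp.mpr ?_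
      nlinarith [mul_le_mul_of_nonneg_left hthr hδκ]
    calc ∑ q ∈ univ.filter (fun q : UT N × Cp => cellOf S hS hdivS lvl zc hcover q.1 = k'), F q * Real.exp (κ' * sdist bsrc btgt n x q.1)
        ≤ ∑ q ∈ univ.filter (fun q : UT N × Cp => cellOf S hS hdivS lvl zc hcover q.1 = k'), F q * Real.exp (κ' * (D k' + 2 * d)) :=
          Finset.sum_le_sum fun q hq => mul_le_mul_of_nonneg_left (hw q hq) (hF0 q)
      _ = (∑ q ∈ univ.filter (fun q : UT N × Cp => cellOf S hS hdivS lvl zc hcover q.1 = k'), F q) * Real.exp (κ' * (D k' + 2 * d)) := by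
          rw [Finset.sum_mul]
      _ ≤ 𝔅g * (n x : ℝ) * Real.exp (-(δ * D k')) * Real.exp (κ' * (D k' + 2 * d)) :=
          mul_le_mul_of_nonneg_right h2 (Real.exp_pos _).le
      _ = 𝔅g * (n x : ℝ) * (Real.exp (κ' * (D k' + 2 * d)) * Real.exp (-(δ * D k'))) := by ring
      _ ≤ 𝔅g * (n x : ℝ) * (Real.exp (2 * d * δ) * Real.exp (-((δ - κ') * Dc k'))) := mul_le_mul_of_nonneg_left hexp (by positivity)
      _ = _ := by ring
  have hfib : ∑ q, F q * Real.exp (κ' * sdist bsrc btgt n x q.1) =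
      ∑ k', ∑ q ∈ univ.filter (fun q : UT N × Cp => cellOf S hS hdivS lvl zc hcover q.1 = k'), F q * Real.exp (κ' * sdist bsrc btgt n x q.1) := by
    rw [← Finset.sum_fiberwise (s := (univ : Finset (UT N × Cp))) (g := fun q => cellOf S hS hdivS lvl zc hcover q.1)]
  have hsum : ∑ k', Real.exp (-((δ - κ') * Dc k')) ≤ N₀ * Λ / (1 - Λ * Real.exp (-(δ - κ'))) :=
    sum_exp_neg_le_of_growth Dc (fun k' => sdist_nonneg bsrc btgt n _ _) hN₀ hΛ (hcount (cellOf S hS hdivS lvl zc hcover x)) hδκ hq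
  have hK : 0 ≤ 𝔅g * Real.exp (2 * d * δ) * (n x : ℝ) := by positivity
  have hgoal : ∑ q, F q * Real.exp (κ' * sdist bsrc btgt n x q.1) ≤
      𝔅g * Real.exp (2 * d * δ) * (N₀ * Λ / (1 - Λ * Real.exp (-(δ - κ')))) * (n x : ℝ) := by
    rw [hfib]
    calc ∑ k', ∑ q ∈ univ.filter (fun q : UT N × Cp => cellOf S hS hdivS lvl zc hcover q.1 = k'), F q * Real.exp (κ' * sdist bsrc btgt n x q.1)
        ≤ ∑ k', 𝔅g * Real.exp (2 * d * δ) * (n x : ℝ) * Real.exp (-((δ - κ') * Dc k')) := Finset.sum_le_sum fun k' _ => hcell k'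
      _ = 𝔅g * Real.exp (2 * d * δ) * (n x : ℝ) * ∑ k', Real.exp (-((δ - κ') * Dc k')) := by rw [Finset.mul_sum]
      _ ≤ 𝔅g * Real.exp (2 * d * δ) * (n x : ℝ) * (N₀ * Λ / (1 - Λ * Real.exp (-(δ - κ')))) := mul_le_mul_of_nonneg_left hsum hK
      _ = _ := by ring
  simpa only [hG, hn, hx, hF] using hgoal

/-- **The growth clause DISCHARGED by the grading** (road P3's `cell_growth_add`, free `ε > 0`), MODULO (FG). [folklore] -/
theorem wrs_grad_levelOp_inverse_le_of_grading
    (hFG : ∀ (x₀ : UT N) (R : ℕ), 1 ≤ R → (∀ i, 10 * R + 4 ≤ N i) → ∀ (w : UT N → ℝ) (M G : ℝ),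
      (∀ x ∈ univ.filter (fun x : UT N => dist x x₀ ≤ 2 * R + 2), |w x| ≤ M) →
      (∀ x ∈ univ.filter (fun x : UT N => dist x x₀ ≤ 2 * R + 2),
        |((∑ b ∈ univ.filter (fun b : UT N × Fin d => btgt b = x), c b ^ 2) +
              ∑ b ∈ univ.filter (fun b : UT N × Fin d => bsrc b = x), c b ^ 2) * w x -
            ((∑ b ∈ univ.filter (fun b : UT N × Fin d => btgt b = x), c b ^ 2 * w (bsrc b)) +
              ∑ b ∈ univ.filter (fun b : UT N × Fin d => bsrc b = x), c b ^ 2 * w (btgt b))| ≤ G) →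
      ∀ μ, |w (up x₀ μ) - w x₀| ≤ K₁ * M / ((R : ℝ) + 1) + K₂ * ((R : ℝ) + 1) * G / c₀ ^ 2)
    {ε : ℝ} (hε : 0 < ε) {κ' : ℝ} (hκ'0 : 0 ≤ κ') (hκ'δ : κ' ≤ δ)
    (hq : Real.exp (ε + 2 * (Real.log L / R) * d) * Real.exp (-(δ - κ')) < 1) (b : UT N × Fin d) (i : Cp) :
    ∑ q, |covD bsrc btgt c Rm ((Ring.inverse (levelOp bsrc btgt c Rm (fun l x => ctrU N (S l) (tblk (hS l) (hdivS l) x))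
          (fun l x => ω l (ctrU N (S l) (tblk (hS l) (hdivS l) x))) T a)) (Pi.single q 1)) (b, i)| *
        Real.exp (κ' * sdist bsrc btgt (siteScale S hS hdivS lvl zc hcover) (bsrc b) q.1) ≤
      𝔅g * Real.exp (2 * d * δ) *
        ((3 * ((L : ℝ) ^ A) ^ 2) ^ d * ((d.factorial : ℝ) / ε ^ d) * Real.exp (2 * d * (ε + Real.log L / R * d)) *
            Real.exp (ε + 2 * (Real.log L / R) * d) /
          (1 - Real.exp (ε + 2 * (Real.log L / R) * d) * Real.exp (-(δ - κ')))) *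
        (siteScale S hS hdivS lvl zc hcover (bsrc b) : ℝ) := by
  have hgr : ∀ y, siteScale S hS hdivS lvl zc hcover y = L ^ (e (lvl (cellOf S hS hdivS lvl zc hcover y))) := fun y => by
    rw [siteScale, hSe]
  have hcount := fun (k : K) (m : ℕ) =>
    cell_growth_add S hS hdivS lvl zc hdisj hcover hL (fun y => e (lvl (cellOf S hS hdivS lvl zc hcover y))) hgr hR (A := A)
      hadd hε k m
  exact wrs_grad_levelOp_inverse_le_of_growth S hS hdivS lvl zc hdisj hcover Rm hRm hflat T hT a ha ω hsupp hamax hscale c hcc hc₀ hL e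
    hSe hR hadd hc hcoer hκ0 hκ1 hμ hrate hΓ hθ hδ h𝔅 hK₁ hK₂ h𝔅g hFG (by positivity) (Real.exp_pos _).le hcount hκ'0 hκ'δ hq b i

end

end Summit.QuantumFields.BalabanUV.Beta.MultiscaleGradRowSums
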